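import Mathlib
import HarnessLib
import Summits.NavierStokesRegularity.NavierStokesRegularity.Theorems.TaoLadderRungTwoBreakEternalRigidityViscBddOneGeometricWake

/-!
# Crux `TaoLadderRungTwoBreak.EternalRigidityViscBddOne` (stmt-NavierStokesRegularity-20420): the registered stub (ω4)
# `stub_eternalLimitViscBdd` VERBATIM from two typed per-trajectory statements — (FE⋆) front a=1 envelope and (HLg⋆) geometric
# half-life co-moving envelope

MODEL lattice ODEs only (Tao 2016 §4, `m = 4`, registered vocabulary `ViscousUpTo`/`BlowsUpAt`/`TypeOne` of skeleton `85fbfe8e90eea58b`);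
nothing here is a statement about the Navier–Stokes equations; no stub, crux or summit is closed (`--supports` ⟨20420⟩).
`stub_eternalLimitViscBdd_of_frontEnvelope_geometricWake` packages the chain of this hand's `…UniformAction`, `…UniformActionHalfLife`,
`…GeometricWake` with g19's `eternalLimitViscBdd_of_frontData`: the REGISTERED signature of (ω4) (threshold `εs = 1`, any would do)
follows from
* (FE⋆) for every sub-threshold type-I viscous blow-up trajectory of a table of the class: a late-time bound
  `(1+ε₀)^{F/2}|X_{i,F}(t)| ≤ Q` at every critical-front mode (`1/(32(3+Λ)) ≤ Λ^F|X_{i,F}(t)|(t⋆−t)`) — equivalently the LOWER CLOCK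
  `m₁ ≤ ν(1+ε₀)^{2F}(t⋆−t)` (the front never runs behind the viscous self-similar schedule; no super-survival of the wake);
* (HLg⋆) for every such trajectory: a profile `p ≥ 0`, summable over `ℤ`, with `p n ≤ p₀(1+ε₀)^{2n}`, bounding
  `Λ^{n+F}(t⋆−t_a)‖X_{n+F}(t)‖ ≤ p n` for one half-life `t ∈ [t_a, t_a+(t⋆−t_a)/2]` after every late anchor `t_a` with front shell `F`
  (precursor decay ahead of the front; wake damped at the clock rate behind it — both exact for a viscous DSS trajectory, whose
  clock-covariant period is `T = 2 log(1+ε₀)`).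
These two are the EXACT typed residual of (ω4) after this hand (sizes: each [L], dynamical; (ω3) `stub_typeOne` is the third input of
the registered composition and is Target-hard).  HONEST LABEL: packaging; (FE⋆), (HLg⋆), (ω3), (ω4), ⟨20420⟩ and every NS statement
remain OPEN; rung 0.
-/

noncomputable section

-- the summit and its single sub-problem share the name (CONVENTIONS §1)
set_option linter.dupNamespace false

open Set Filter Topology MeasureTheory
open Literature.Analysis.FluidPDE Literature.Analysis.FluidPDE.TaoCascade
open Summit.NavierStokesRegularity.NavierStokesRegularity.Theorems.EternalRigidityViscBddOne.Birth

namespace Summit.NavierStokesRegularity.NavierStokesRegularity.Theorems.EternalRigidityViscBddOne.UniformAction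

/-- **(ω4) VERBATIM ⟸ (FE⋆) ∧ (HLg⋆).**  The registered signature of `stub_eternalLimitViscBdd` (skeleton `85fbfe8e90eea58b`) from the
two typed per-trajectory statements (FE⋆) (front a=1 envelope at late critical-front modes) and (HLg⋆) (geometric half-life co-moving
envelope), via `eternalLimitViscBdd_of_geometricHalfLifeWake`; the threshold is irrelevant (`εs = 1`).  MODEL lattice only; nothing closed.
[cite: Tao2016AveragedNS, §4 Thm. 4.2 (statement shape), the viscous equation before it, §6.4; KochNadirashviliSereginSverak2009, Thm 1.1 ff.; cell vocabulary (stmt-NavierStokesRegularity-20420)] -/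
theorem stub_eternalLimitViscBdd_of_frontEnvelope_geometricWake
    (hFE : ∀ (R ε₀ : ℝ), 1 ≤ R → 0 < ε₀ →
      ∀ (α : Fin 4 → Fin 4 → Fin 4 → ℤ × ℤ × ℤ → ℝ) (X₀ : Fin 4 → ℝ), InTableClass R α →
        ∀ ν : ℝ, 0 < ν → ∀ (X : Fin 4 → ℤ → ℝ → ℝ) (tStar : ℝ),
          ViscousUpTo ε₀ ν α X₀ X tStar → BlowsUpAt ε₀ X tStar → TypeOne ε₀ X tStar →
            ∃ Q t₂ : ℝ, t₂ < tStar ∧ ∀ t : ℝ, 0 ≤ t → t₂ ≤ t → t < tStar → ∀ (i : Fin 4) (F : ℤ),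
              1 / (32 * (3 + bigLam ε₀)) ≤ bigLam ε₀ ^ F * |X i F t| * (tStar - t) →
                (1 + ε₀) ^ ((F : ℝ) / 2) * |X i F t| ≤ Q)
    (hHLg : ∀ (R ε₀ : ℝ), 1 ≤ R → 0 < ε₀ →
      ∀ (α : Fin 4 → Fin 4 → Fin 4 → ℤ × ℤ × ℤ → ℝ) (X₀ : Fin 4 → ℝ), InTableClass R α →
        ∀ ν : ℝ, 0 < ν → ∀ (X : Fin 4 → ℤ → ℝ → ℝ) (tStar : ℝ),
          ViscousUpTo ε₀ ν α X₀ X tStar → BlowsUpAt ε₀ X tStar → TypeOne ε₀ X tStar →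
            ∃ (p : ℤ → ℝ) (p₀ t₃ : ℝ), (∀ n, 0 ≤ p n) ∧ Summable p ∧
              (∀ n : ℤ, p n ≤ p₀ * (1 + ε₀) ^ ((2 : ℝ) * n)) ∧ t₃ < tStar ∧
              ∀ ta : ℝ, 0 ≤ ta → t₃ ≤ ta → ta < tStar → ∀ (i : Fin 4) (F : ℤ),
                1 / (32 * (3 + bigLam ε₀)) ≤ bigLam ε₀ ^ F * |X i F ta| * (tStar - ta) →
                  ∀ (n : ℤ) (t : ℝ), ta ≤ t → t ≤ ta + (tStar - ta) / 2 →
                    bigLam ε₀ ^ (n + F) * (tStar - ta) * ‖shellVec X (n + F) t‖ ≤ p n) :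
    ∀ R : ℝ, 1 ≤ R → ∃ εs : ℝ, 0 < εs ∧ ∀ ε₀ : ℝ, 0 < ε₀ → ε₀ ≤ εs →
      ∀ (α : Fin 4 → Fin 4 → Fin 4 → ℤ × ℤ × ℤ → ℝ) (X₀ : Fin 4 → ℝ), InTableClass R α →
        ∀ ν : ℝ, 0 < ν → ∀ (X : Fin 4 → ℤ → ℝ → ℝ) (tStar : ℝ),
          ViscousUpTo ε₀ ν α X₀ X tStar → BlowsUpAt ε₀ X tStar → TypeOne ε₀ X tStar →
            ∃ (νh : ℝ) (W : ℤ → ℝ → Em 4), IsEternalVisc ε₀ νh α W ∧ UniformBound W ∧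
              EternalSurvivingFwd 1 ε₀ W := by
  intro R hR
  refine ⟨1, one_pos, fun ε₀ hε₀ _ α X₀ hα ν hν X tStar hV hB hT1 => ?_⟩
  have hEnv := hFE R ε₀ hR hε₀ α X₀ hα ν hν X tStar hV hB hT1
  obtain ⟨p, p₀, t₃, hp0, hps, hpg, ht₃T, hhl⟩ := hHLg R ε₀ hR hε₀ α X₀ hα ν hν X tStar hV hB hT1
  obtain ⟨νh, _, W, hW, hU, hS, _⟩ :=
    eternalLimitViscBdd_of_geometricHalfLifeWake hε₀ hν hα hV hB hT1 hEnv hp0 hps hpg ⟨t₃, ht₃T, hhl⟩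
  exact ⟨νh, W, hW, hU, hS⟩

end Summit.NavierStokesRegularity.NavierStokesRegularity.Theorems.EternalRigidityViscBddOne.UniformAction

end
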